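import Summits.CriticalPhenomena.PercolationContinuityZ3.Theorems.Transplant.BoxProdZ2Boxes
import Summits.CriticalPhenomena.PercolationContinuityZ3.Theorems.Transplant.UniqZoneGeneric
import HarnessLib

/-!
# Φ2-prod: the uniqueness zone over the PRISMS of `X □ ℤ²` (Kozma–Nitzan Lemma 7 for Target 1), from a.s. uniqueness

builds on p205010 (kernel theorem, internal audit signed; external expert review pending) — nothing in this file uses p205010.
Lane `prim-bschramm`, BLUEPRINT-I-PHI §3 Φ2 instantiated for §6 Target 1; seat `prim-bschramm-p2`; helper file.  No definitions, no sorries.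
The generic theorem `UniqZone.exists_forall_le_lt_real_zone` (`Transplant/UniqZoneGeneric.lean`) applied to the cubic prisms
`Λ n := BoxProdZ2.prismFin X x n c n` (fibre ball of radius `n` × square of half-side `n` centred at `c`): they are monotone, nested with
margin (`outerBoundary_prismBox_subset`), and exhaust `W × ℤ²` when `X` is connected.  The uniqueness input `hU` is stmt's
`boxProdZ2_numInfiniteClusters_le_one` (Burton–Keane for amenable q.t. `X`) or any other source.

* `BoxProdZ2.prismFin_succ_margin` — `∂^{out} prismFin n ⊆ prismFin (n+1)`;
* `BoxProdZ2.prismFin_exhaust` — every vertex lies in some `prismFin X x n c n` (`X` connected);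
* `BoxProdZ2.exists_forall_le_lt_real_uniqZone_prism` — **Lemma 7 over prisms**: ∀ k, η > 0, ∃ n₀, ∀ n ≥ n₀,
  `P_p(UniqZone.zone (X □ zdGraph 2) (fun n => prismFin X x n c n) k n) > 1 − η`.

[cite: KozmaNitzan2024, §4 Lemma 7 (p. 15)] [cite: MartineauTassion2017, §3.3 (Lemma 3.7)]
-/

noncomputable section

namespace Summit.CriticalPhenomena.PercolationContinuityZ3.Theorems

namespace Transplant

namespace BoxProdZ2

open MeasureTheory Literature.Probability.Percolation Literature.Probability.LatticeModels
open Literature.Barriers.CriticalPhenomena (graphBall)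

variable {W : Type*} [DecidableEq W] (X : SimpleGraph W) [X.LocallyFinite]

omit [DecidableEq W] in
/-- The cubic prisms `prismFin X x n c n` increase with `n`. [folklore] -/
theorem prismFin_monotone (x : W) (c : Site 2) : Monotone fun n : ℕ => prismFin X x n c n := by
  intro n m hnm
  show prismBox X x n (c - (n : Site 2)) (c + (n : Site 2)) ⊆ prismBox X x m (c - (m : Site 2)) (c + (m : Site 2))
  refine prismBox_mono X x hnm (fun i => ?_) (fun i => ?_) <;>
    simp only [Pi.sub_apply, Pi.add_apply, Pi.natCast_apply] <;> omega

/-- **Margin**: the outer boundary of the prism of scale `n` lies in the prism of scale `n+1`. [folklore] -/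
theorem prismFin_succ_margin (x : W) (c : Site 2) (n : ℕ) :
    outerBoundary (X □ zdGraph 2) (prismFin X x n c n) ⊆ prismFin X x (n + 1) c (n + 1) := by
  refine (outerBoundary_prismBox_subset X x n _ _).trans (prismBox_mono X x le_rfl (fun i => ?_) (fun i => ?_)) <;>
    simp only [Pi.sub_apply, Pi.add_apply, Pi.natCast_apply, Pi.one_apply] <;> push_cast <;> omega

omit [DecidableEq W] in
/-- **Exhaustion**: for `X` connected every vertex of `W × ℤ²` lies in some prism `prismFin X x n c n`. [folklore] -/
theorem prismFin_exhaust (hX : X.Connected) (x : W) (c : Site 2) (v : W × Site 2) : ∃ n : ℕ, v ∈ prismFin X x n c n := by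
  obtain ⟨wk⟩ := hX.preconnected x v.1
  set m : ℕ := wk.length + ∑ i, ((v.2 - c) i).natAbs with hm
  refine ⟨m, ?_⟩
  rw [mem_prismFin_iff]
  refine ⟨⟨wk, by omega⟩, ?_⟩
  rw [mem_box]
  intro i
  have hi : ((v.2 - c) i).natAbs ≤ ∑ j, ((v.2 - c) j).natAbs :=
    Finset.single_le_sum (f := fun j => ((v.2 - c) j).natAbs) (fun _ _ => Nat.zero_le _) (Finset.mem_univ i)
  constructor <;> omega

/-- **Kozma–Nitzan's Lemma 7 over the prisms of `X □ ℤ²`**: given a.s. uniqueness of the infinite cluster at `p` (input U), for every `k`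
and `η > 0` there is `n₀` such that for all `n ≥ n₀`, with probability `> 1 − η` any two vertices of the prism of scale `k`, each joined inside the
prism of scale `n` to its inner boundary, are joined to each other inside it. [cite: KozmaNitzan2024, §4 Lemma 7] [cite: MartineauTassion2017, §3.3] -/
theorem exists_forall_le_lt_real_uniqZone_prism [Countable W] (hX : X.Connected) (x : W) (c : Site 2) (p : unitInterval)
    (hU : ∀ᵐ ω ∂(bondPercolation (X □ zdGraph 2) p), numInfiniteClusters ω ≤ 1) (k : ℕ) {η : ℝ} (hη : 0 < η) :
    ∃ n₀ : ℕ, ∀ n, n₀ ≤ n →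
      1 - η < (bondPercolation (X □ zdGraph 2) p).real (UniqZone.zone (X □ zdGraph 2) (fun n => prismFin X x n c n) k n) :=
  UniqZone.exists_forall_le_lt_real_zone p hU (prismFin_succ_margin X x c) (prismFin_monotone X x c) (prismFin_exhaust X hX x c) k hη

end BoxProdZ2

end Transplant

end Summit.CriticalPhenomena.PercolationContinuityZ3.Theorems

end
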